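/-
Copyright (c) 2026 the pub-hodgecm-mathlib formalisation cell (harness21).  Prover seat hodgecm-mathlib-F0P2-p11 (g3): Track B «K2-LIT»,
hLiu418 = stmt-HodgeConjecture-24832; LEAD F0P6-plan (g14) BATCH #155 (1) «(K1a-3) ∕ D-2 `hWfac` BAD-PLACE REGULARITY — bad factor = const × ball-stable
value», line lead K2E5-p16 (g8); the BALL EDITION of ★ `K2LiuRankOneStageTwisted` (K2E3-p29 (g2)).
-/
import Summits.HodgeConjecture.HodgeConjecture.Theorems.K2LiuRankOneStageTwisted     -- ★ (K1a-3)-S `integrable_and_integral_eq_twisted`, `exists_twisted_family` (+ ★ B3 ∕ B5a ∕ B7-S ∕ F1)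
import HarnessLib

/-!
# Crux `HLiu418`, road `K2_Liu`, KIND 1 a♮ (the singular big-cell term), file (K1a-3)-S-BALL:
# THE ψ-TWISTED RANK-ONE STAGE IS ONE BALL INTEGRAL, STABLE ON ALL LARGE BALLS, FOR EVERY SECTION — the `hWfac` shape «const × ball-stable value»

Cell `hodgecm-mathlib`, crux item hLiu418 = `stmt-HodgeConjecture-24832`; squad K2 ∕ K2Liu; prover F0P2-p11 (g3) (LEAD F0P6-plan (g14) BATCH #155 (1),
line lead K2E5-p16 (g8); K1 desk lineage F0P2-p11 (g0∕g2)).  THEOREMS ONLY (no `def`, no instance, no notation, no named-fact hypothesis, no `sorry`); lane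
`--supports stmt-HodgeConjecture-24832 --as helper` (count-neutral helper).  Currency = ★ `K2LiuRankOneStageTwisted` VERBATIM (a group `G`, the completion `K_w`,
an additive Haar measure `μ`, the rank-one letters `u ū w₀ ν e C₀ hrel` of ★ B3, a right level `K′`, an additive character `ψ`, a scalar `σ`).

THE POINT.  ★ (K1a-3)-S `K2LiuRankOneStageTwisted.exists_twisted_family` proves that the TWISTED last stage of the GK-cocycle road to the rank-one (corner-index)
Fourier coefficient of the Siegel big cell — `∫ conj ψ(σx) · Φ_s(w₀ u(x) g) dμ(x)` — is, on `1 < re s`, an explicit `N s g` regular at EVERY `s₀`; but it exports `N`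
only EXISTENTIALLY («(i) regular, (ii) `∫ = N` where the integral converges»).  The coset-sum ∕ ball form of `N` stays inside its proof, so no consumer can read the
CONTINUED bad-place factor `Gn_v(½, h) = c_N · L_F(2,χ_F) · L_{E∕F}(1,χ_F∘N) · N(½, h)` of ★ `K2LiuRankOneSingularLocalRegularity` (K2E3-p29) — where the full
`x`-integral does NOT converge absolutely — as «a constant times a value stable on balls», which is exactly the `hWfac` letter of ★ p862742
`K2LiuIncoherentDeadPlacesBadRow.hbad_of_ballLetters` (`W X j h v = cW X j h v · V X j h v k` for all large `k`).  THIS FILE exports that ball form: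
* §1 (any non-archimedean local field) **`setIntegral_ball_diff_twisted_eq_zero`** — ★ p29's TAIL lemma ON THE ANNULUS `𝔭^{n′} ∖ 𝔭^{n}` between two
  balls (`n′ ≤ n`): if there the integrand is `C·ν(x)⁻¹·‖x‖^{−e}·conj ψ(σx)` with `ν` invariant under `x ↦ x + t₀` for one `t₀ ∈ 𝔭^n` with
  `ψ(σt₀) ≠ 1`, the annulus integral is `0` — ONE additive translation (★ F1 `setIntegral_eq_zero_of_translate`); no integrability hypothesis (an annulus is compact
  anyway), no Gauss sum.
* §2 (fixed function; the letters of ★ `integrable_and_integral_eq_twisted` VERBATIM **minus the integrability `hint₀`**, plus a ball exponent `k ≥ m`)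
  **`setIntegral_ball_twisted_eq_sum`**: `∫_{x ∈ 𝔭^{−k}} conj ψ(σx) · f(w₀ u(x) y) dμ(x) = Σ_{a∈R} μ(𝔭^m) · conj ψ(σa) · f(w₀ u(a) y)` for EVERY `k ≥ m` — the ball
  integrals are STABLE past the coset level `m` and equal the head sum; valid for every section (every `s`, the point `s = ½` included, where `hint₀` fails).
  With `hint₀` as well, `setIntegral_ball_twisted_eq_integral` recovers ★ p29's value `= ∫ conj ψ(σx) f(w₀ u(x) y) dμ`.
* §3 (family form) **`exists_twisted_family_ball`** — ★ `exists_twisted_family`'s binders and its two clauses VERBATIM for the SAME explicit `N`, PLUS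
  (iii) **`∀ g, ∃ k₀, ∀ s, ‹Φ_s right-K′-invariant› → ‹Φ_s satisfies the SL₂ relation› → ∀ k ≥ k₀, N s g = ∫_{x ∈ 𝔭^{−k}} conj ψ(σx) · Φ_s(w₀ u(x) g) dμ(x)`**
  (ONE threshold `k₀ = m(g)` for all `s`; the two letters are the ones (ii) assumes on the half-plane, asked at the point `s` only); the Laurent monomial
  `isQRationalRegularAt_normAbs_cpow_neg_affine` (`s ↦ ‖x‖^{−(as+c)}` is `q₀^{-s}`-rational, regular everywhere); and **`exists_twisted_family_ball_regular`** —
  (iii′) the ball clause at EVERY `s₀` where the point values of `Φ` and the scalar `C₀` are `q₀^{-s}`-rational and regular (`q₀ ≥ 2`, `q_w = q₀^d`), the two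
  letters being TRANSFERRED from the half-plane by the identity principle ★ `IsQRationalRegularAt.eq_of_eqOn_halfPlane`.  At `s₀ = ½` this is the `hWfac` shape
  with `cW := 1` for the twisted stage, hence with `cW := c_N · L_F(2,χ_F) · L_{E∕F}(1,χ_F∘N)` (times the face scalars) for `W X h v := Gn_v(½, h_v)` once ★ p29
  §2's chain (`N₂` regular at every `s₀`, `C₀ = localSiegelCharacter(…)·const`) is re-run over this edition (frame-level sibling `…TwistedBallFrame`, F0P2-p11 next).
WHAT STAYS BY VALUE for the D-2 `hV` row (K2Liu-p12 (g5)): identifying the ball value `∫_{𝔭^{−k}} conj ψ(σx)·N₂(½)(φ(w₂)φ(u_{2e₂}(ιxδ)) h) dμ` of the stage-B normalised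
family with ★ W1-fin's ball average `∫_{C k} (Γ(σ(w₁ n(bτ))Ψ))(0) ψ_v(β′b) dμ` (the seam (τ) of the K1-a♮ census §3 (K1a-4): along `φ(corner)` the inner section IS
the local line's SW section) — not here.
HONEST LABEL.  `HC_CM` is proved only modulo the 7 printed citations (2 remaining named inputs: hLiu418 = `stmt-HodgeConjecture-24832`,
h413 = `stmt-HodgeConjecture-24833`) until rung 0 closes; this file is a count-neutral helper and closes no socket.

## References
* [Casselman1980] W. Casselman, *The unramified principal series of p-adic groups I*, Compositio Math. 40 (1980), §3 Thm. 3.1 (rank-one operators, the cocycle).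
* [CasselmanShalika1980] W. Casselman, J. Shalika, Compositio Math. 41 (1980), §2 (the Whittaker functional along a rank-one step; far shells vanish — Karel).
* [Tate1950] J. Tate, *Fourier analysis in number fields and Hecke's zeta-functions* (1950), §2.2, §2.5 (conductor of `ψ`, `∫_{𝔭^n} ψ(xy) dx`).
* [KudlaRallis1994] S. Kudla, S. Rallis, Ann. of Math. 140 (1994), §2 (Fourier coefficients of the Siegel big cell at singular indices).
-/

set_option autoImplicit false
set_option linter.dupNamespace false -- the mandated namespace repeats `HodgeConjecture.HodgeConjecture`

noncomputable section

open MeasureTheory Filter Topology Set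
open scoped NNReal ENNReal ComplexConjugate
open NumberField IsDedekindDomain
open Literature.NumberTheory.GaloisRepresentations.IsNonarchimedeanLocalField
open Literature.NumberTheory.Automorphic Literature.NumberTheory.Automorphic.LocalFieldHaar
open Summit.HodgeConjecture.HodgeConjecture.Cruxes.HLiu418.K2LiuQRationalDefs
open Summit.HodgeConjecture.HodgeConjecture.Cruxes.HLiu418.K2LiuRankOneLevelShells
open Summit.HodgeConjecture.HodgeConjecture.Cruxes.HLiu418.K2LiuRankOneLevelHolomorphy
open Summit.HodgeConjecture.HodgeConjecture.Cruxes.HLiu418.K2LiuRankOneOperators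
open Summit.HodgeConjecture.HodgeConjecture.Cruxes.HLiu418.K2LiuRankOneStage
open Summit.HodgeConjecture.HodgeConjecture.Cruxes.HLiu418.K2LiuRankOneStageTwisted
open Summit.HodgeConjecture.HodgeConjecture.Cruxes.HLiu418.K2LiuShellVanishingByAveraging
open Summit.HodgeConjecture.HodgeConjecture.Cruxes.HLiu418.K2LiuAddCharTrivialOnLattice (le_normAbs_of_not_mem_primePowBall)

namespace Summit.HodgeConjecture.HodgeConjecture.Cruxes.HLiu418.K2LiuRankOneStageTwistedBall

/-! ## §1 The TAIL lemma of ★ p29 on an annulus between two balls -/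

section LocalField

variable {F : Type*} [Field F] [ValuativeRel F] [TopologicalSpace F] [IsNonarchimedeanLocalField F]
variable [MeasurableSpace F] [BorelSpace F] (μ : Measure F) [μ.IsAddHaarMeasure]

/-- **THE TWISTED TAIL INTEGRAND DIES ON EVERY ANNULUS `𝔭^{n′} ∖ 𝔭^{n}` (`n ≤ n′` read as balls `𝔭^{n} ⊆ 𝔭^{n′}`).**  On the complement of `𝔭^n` let
`h(x) = C · ν(x)⁻¹ · ‖x‖^{−e} · conj ψ(σx)`, and let `t₀ ∈ 𝔭^n` satisfy `ψ(σt₀) ≠ 1` and leave `ν` invariant off `𝔭^n`.  Then for every `n′ ≤ n`,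
`∫_{𝔭^{n′} ∖ 𝔭^{n}} h dμ = 0`: the substitution `x ↦ x + t₀` preserves BOTH balls (so the annulus), `‖·‖` and `ν` there, and multiplies `h` by `conj ψ(σt₀) ≠ 1`
(★ F1 `setIntegral_eq_zero_of_translate`; ★ p29 `setIntegral_compl_twisted_eq_zero` is the case «annulus = whole complement»). [cite: Tate1950, §2.5]
[cite: CasselmanShalika1980, §2] -/
theorem setIntegral_ball_diff_twisted_eq_zero (n n' : ℤ) (hn : n' ≤ n) (h : F → ℂ) (ν : Fˣ →* ℂˣ) (C e : ℂ) {ψ : AddChar F Circle} (σ : F) {t₀ : F}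
    (ht₀ : t₀ ∈ primePowBall F n) (hψt₀ : ψ (σ * t₀) ≠ 1)
    (hν : ∀ (x : F) (hx : x ∉ primePowBall F n),
      ν (Units.mk0 (x + t₀) (ne_zero_of_not_mem_primePowBall fun h' => hx ((add_mem_primePowBall_iff_of_mem ht₀ x).1 h'))) =
        ν (Units.mk0 x (ne_zero_of_not_mem_primePowBall hx)))
    (htail : ∀ (x : F) (hx : x ∉ primePowBall F n),
      h x = C * (((ν (Units.mk0 x (ne_zero_of_not_mem_primePowBall hx)))⁻¹ : ℂˣ) : ℂ) * ((normAbs F x : ℝ) : ℂ) ^ (-e) *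
        conj ((ψ (σ * x)) : ℂ)) :
    ∫ x in primePowBall F n' \ primePowBall F n, h x ∂μ = 0 := by
  have hζ : conj ((ψ (σ * t₀) : Circle) : ℂ) ≠ 1 := by
    intro h1
    apply hψt₀
    have h2 : ((ψ (σ * t₀) : Circle) : ℂ) = 1 := by
      have := congrArg conj h1
      simpa using this
    exact Circle.coe_eq_one.1 h2
  have ht₀' : t₀ ∈ primePowBall F n' := primePowBall_antitone hn ht₀
  refine setIntegral_eq_zero_of_translate μ ((measurableSet_primePowBall n').diff (measurableSet_primePowBall n)) (t := t₀)
    (fun x => ?_) (fun x hx => ?_) hζ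
  · simp only [Set.mem_sdiff, add_mem_primePowBall_iff_of_mem ht₀ x, add_mem_primePowBall_iff_of_mem ht₀' x]
  · have hx : x ∉ primePowBall F n := hx.2
    have hxt : x + t₀ ∉ primePowBall F n := fun h' => hx ((add_mem_primePowBall_iff_of_mem ht₀ x).1 h')
    rw [htail (x + t₀) hxt, htail x hx, hν x hx, normAbs_add_eq_of_not_mem hx ht₀, mul_add, AddChar.map_add_eq_mul, Circle.coe_mul,
      map_mul]
    ring

end LocalField

/-! ## §2 The twisted rank-one stage at a completion `K_w`: the BALL integrals of a fixed function are stable past the coset level -/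

section Fixed

variable {K : Type} [Field K] [NumberField K] {w : HeightOneSpectrum (𝓞 K)} {G : Type*} [Group G]
variable [MeasurableSpace (w.adicCompletion K)] [BorelSpace (w.adicCompletion K)] (μ : Measure (w.adicCompletion K)) [μ.IsAddHaarMeasure]

/-- **THE TWISTED RANK-ONE STAGE IS ONE BALL INTEGRAL, STABLE PAST THE COSET LEVEL (fixed function, NO integrability hypothesis).**  In the letters of
★ `integrable_and_integral_eq_twisted` (right-`K′`-invariant `f`, the `SL₂` relation `hrel`, a level `m₀` at `y`, an additive character `ψ`, a scalar `σ`, a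
coset level `m ≥ m₀` past the two thresholds — `ψ(σ·)` trivial on `𝔭^m` (HEAD) and non-trivial somewhere on `𝔭^{2m₀−m}` (TAIL) — representatives `R` of
`𝔭^{−m} ⧸ 𝔭^m`) but WITHOUT `hint₀`: for every ball exponent `k ≥ m`,
**`∫_{x ∈ 𝔭^{−k}} conj ψ(σx) · f(w₀ u(x) y) dμ(x) = Σ_{a∈R} μ(𝔭^m) · conj ψ(σa) · f(w₀ u(a) y)`** — the head ball `𝔭^{−m}` gives the coset sum (★ B5a), the annulus
`𝔭^{−k} ∖ 𝔭^{−m}` gives `0` (§1 with ★ p29's conductor argument, or the tail integrand is identically `0`).  This is Karel's lemma for the twisted rank-one stage: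
the local coefficient IS a compact-ball integral, for every section. [cite: CasselmanShalika1980, §2] [cite: Casselman1980, §3 Thm. 3.1] [cite: Tate1950, §2.5]
[cite: KudlaRallis1994, §2] -/
theorem setIntegral_ball_twisted_eq_sum {f : G → ℂ} {K' : Subgroup G} (hfK : ∀ g, ∀ k ∈ K', f (g * k) = f g)
    {u ū : w.adicCompletion K → G} (hu_add : ∀ x t, u (x + t) = u x * u t) (w₀ : G)
    (ν : (w.adicCompletion K)ˣ →* ℂˣ) (e C₀ : ℂ)
    (hrel : ∀ (x : (w.adicCompletion K)ˣ) (g : G),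
      f (w₀ * u x * g) = C₀ * (((ν x)⁻¹ : ℂˣ) : ℂ) * ((normAbs (w.adicCompletion K) (x : w.adicCompletion K) : ℝ) : ℂ) ^ (-e) *
        f (ū ((x⁻¹ : (w.adicCompletion K)ˣ) : w.adicCompletion K) * g))
    (ψ : AddChar (w.adicCompletion K) Circle) (σ : w.adicCompletion K)
    (y : G) (m₀ m : ℕ) (hm : m₀ ≤ m)
    (hmu : ∀ t ∈ primePowBall (w.adicCompletion K) (m₀ : ℤ), y⁻¹ * u t * y ∈ K')
    (hmū : ∀ t ∈ primePowBall (w.adicCompletion K) (m₀ : ℤ), y⁻¹ * ū t * y ∈ K')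
    (hσm : ∀ t ∈ primePowBall (w.adicCompletion K) (m : ℤ), ψ (σ * t) = 1)
    (htail : ∃ t₀ ∈ primePowBall (w.adicCompletion K) (2 * (m₀ : ℤ) - m), ψ (σ * t₀) ≠ 1)
    (R : Finset (w.adicCompletion K))
    (hRinc : ∀ a ∈ R, ∀ a' ∈ R, a ≠ a' → a - a' ∉ primePowBall (w.adicCompletion K) (m : ℤ))
    (hRcov : primePowBall (w.adicCompletion K) (-(m : ℤ)) = ⋃ a ∈ R, {x | x - a ∈ primePowBall (w.adicCompletion K) (m : ℤ)})
    (k : ℕ) (hk : m ≤ k) :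
    ∫ x in primePowBall (w.adicCompletion K) (-(k : ℤ)), conj ((ψ (σ * x) : ℂ)) * f (w₀ * u x * y) ∂μ =
      ∑ a ∈ R, (μ.real (primePowBall (w.adicCompletion K) (m : ℤ)) : ℂ) * (conj ((ψ (σ * a) : ℂ)) * f (w₀ * u a * y)) := by
  have hq0 : (0 : ℝ≥0) < (residueFieldCard (w.adicCompletion K) : ℝ≥0)⁻¹ := inv_residueFieldCard_pos
  set g : w.adicCompletion K → ℂ := fun x => conj ((ψ (σ * x) : ℂ)) * f (w₀ * u x * y) with hg
  -- `g` is constant on the cosets of `𝔭^m` (HEAD threshold)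
  have hfconst : ∀ x : w.adicCompletion K, ∀ t ∈ primePowBall (w.adicCompletion K) (m : ℤ), f (w₀ * u (x + t) * y) = f (w₀ * u x * y) :=
    fun x t ht => apply_mul_u_add hfK hu_add w₀ y hmu x (primePowBall_antitone (by exact_mod_cast hm) ht)
  have hconst : ∀ x : w.adicCompletion K, ∀ t ∈ primePowBall (w.adicCompletion K) (m : ℤ), g (x + t) = g x :=
    fun x t ht => twisted_const_on_cosets hσm (fun x => f (w₀ * u x * y)) hfconst x ht
  -- HEAD: the coset sum over `𝔭^{-m}`
  have hhead : ∀ a ∈ R, ∀ x, x - a ∈ primePowBall (w.adicCompletion K) (m : ℤ) → g x = g a := by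
    intro a _ x hx
    have h := hconst a (x - a) hx
    rwa [add_sub_cancel] at h
  obtain ⟨-, hheadval⟩ := integrableOn_and_setIntegral_head_eq_sum μ R hRinc hRcov g hhead
  -- integrability on the big ball `𝔭^{-k}` (a locally constant function on a compact ball): ★ B5a with representatives of `𝔭^{-k} ⧸ 𝔭^m`
  obtain ⟨Rk, -, hRkinc, hRkcov⟩ := exists_finset_primePowBall_eq_biUnion (F := w.adicCompletion K) (j := -(k : ℤ)) (r := (m : ℤ)) (by omega)
  have hheadk : ∀ a ∈ Rk, ∀ x, x - a ∈ primePowBall (w.adicCompletion K) (m : ℤ) → g x = g a := by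
    intro a _ x hx
    have h := hconst a (x - a) hx
    rwa [add_sub_cancel] at h
  obtain ⟨hintk, -⟩ := integrableOn_and_setIntegral_head_eq_sum μ Rk hRkinc hRkcov g hheadk
  -- the annulus `𝔭^{-k} ∖ 𝔭^{-m}` contributes nothing
  have hsub : primePowBall (w.adicCompletion K) (-(m : ℤ)) ⊆ primePowBall (w.adicCompletion K) (-(k : ℤ)) :=
    primePowBall_antitone (by omega)
  have hsub₀ : ∀ x : w.adicCompletion K, x ∉ primePowBall (w.adicCompletion K) (-(m : ℤ)) → x ∉ primePowBall (w.adicCompletion K) (-(m₀ : ℤ)) :=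
    fun x hx hx' => hx (primePowBall_antitone (by omega) hx')
  have hann : ∫ x in primePowBall (w.adicCompletion K) (-(k : ℤ)) \ primePowBall (w.adicCompletion K) (-(m : ℤ)), g x ∂μ = 0 := by
    obtain ⟨t₀, ht₀, hψt₀⟩ := htail
    have ht₀' : t₀ ∈ primePowBall (w.adicCompletion K) (-(m : ℤ)) := primePowBall_antitone (by omega) ht₀
    by_cases hC : C₀ * f y = 0
    · -- the tail integrand vanishes identically off `𝔭^{-m}`
      refine (setIntegral_congr_fun ((measurableSet_primePowBall _).diff (measurableSet_primePowBall _)) (g := fun _ => (0 : ℂ))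
        fun x hx => ?_).trans (by simp)
      have hx : x ∉ primePowBall (w.adicCompletion K) (-(m : ℤ)) := hx.2
      show conj ((ψ (σ * x) : ℂ)) * f (w₀ * u x * y) = 0
      rw [apply_eq_tail_of_level hfK w₀ ν e C₀ hrel y m₀ hmū x (hsub₀ x hx), hC, zero_mul, mul_zero]
    · -- `ν` is invariant under `x ↦ x + t₀` off `𝔭^{-m}` (★ p29's conductor), and ONE translation kills the annulus (§1)
      refine setIntegral_ball_diff_twisted_eq_zero μ (-(m : ℤ)) (-(k : ℤ)) (by omega) g ν (C₀ * f y) e σ ht₀' hψt₀ (fun x hx => ?_) (fun x hx => ?_)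
      · have hx0 : x ≠ 0 := ne_zero_of_not_mem_primePowBall hx
        have hxinv : x⁻¹ ∈ primePowBall (w.adicCompletion K) ((m : ℤ) + 1) := by
          rw [mem_primePowBall_iff, map_inv₀]
          have hle := le_normAbs_of_not_mem_primePowBall hx
          have hx0' : (0 : ℝ≥0) < normAbs (w.adicCompletion K) x := (zpow_pos hq0 _).trans_le hle
          rw [inv_le_comm₀ hx0' (zpow_pos hq0 _), ← zpow_neg]
          have heq : -((m : ℤ) + 1) = -(m : ℤ) - 1 := by ring
          rwa [heq]
        have hz : t₀ * x⁻¹ ∈ primePowBall (w.adicCompletion K) (2 * (m₀ : ℤ) + 1) := by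
          have h := mul_mem_primePowBall ht₀ hxinv
          have heq : 2 * (m₀ : ℤ) - m + ((m : ℤ) + 1) = 2 * (m₀ : ℤ) + 1 := by ring
          rwa [heq] at h
        have hz1 : (1 : w.adicCompletion K) + t₀ * x⁻¹ ≠ 0 := by
          intro h0
          have hneg : t₀ * x⁻¹ = -1 := by linear_combination h0
          have hle : normAbs (w.adicCompletion K) (t₀ * x⁻¹) ≤ (residueFieldCard (w.adicCompletion K) : ℝ≥0)⁻¹ ^ (2 * (m₀ : ℤ) + 1) := hz
          rw [hneg, normAbs_neg, map_one] at hle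
          have hlt : (residueFieldCard (w.adicCompletion K) : ℝ≥0)⁻¹ ^ (2 * (m₀ : ℤ) + 1) < (residueFieldCard (w.adicCompletion K) : ℝ≥0)⁻¹ ^ (0 : ℤ) :=
            (zpow_lt_zpow_iff_right_of_lt_one₀ hq0 inv_residueFieldCard_lt_one).2 (by omega)
          rw [zpow_zero] at hlt
          exact absurd (hle.trans_lt hlt) (lt_irrefl 1)
        have hν1 := nu_one_add_eq_one_of_level hfK hu_add w₀ ν e C₀ hrel y m₀ hmu hmū hC (t₀ * x⁻¹) hz hz1
        have hprod : Units.mk0 (x + t₀) (ne_zero_of_not_mem_primePowBall fun h' => hx ((add_mem_primePowBall_iff_of_mem ht₀' x).1 h')) =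
            Units.mk0 x hx0 * Units.mk0 (1 + t₀ * x⁻¹) hz1 := by
          ext
          simp only [Units.val_mk0, Units.val_mul]
          rw [mul_add, mul_one, mul_comm t₀ x⁻¹, ← mul_assoc, mul_inv_cancel₀ hx0, one_mul]
        rw [hprod, map_mul, hν1, mul_one]
      · show conj ((ψ (σ * x) : ℂ)) * f (w₀ * u x * y) = _
        rw [apply_eq_tail_of_level hfK w₀ ν e C₀ hrel y m₀ hmū x (hsub₀ x hx)]
        ring
  -- assemble: `∫_{𝔭^{-k}} = ∫_{𝔭^{-m}} + ∫_{annulus}`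
  have hsplit := setIntegral_sdiff (measurableSet_primePowBall (-(m : ℤ))) hintk hsub
  rw [hann] at hsplit
  have hkm : ∫ x in primePowBall (w.adicCompletion K) (-(k : ℤ)), g x ∂μ = ∫ x in primePowBall (w.adicCompletion K) (-(m : ℤ)), g x ∂μ := by
    have := hsplit.symm
    rwa [sub_eq_zero] at this
  rw [hkm, hheadval]

/-- **… and it is ★ p29's full integral where that converges**: with the integrability `hint₀` of ★ `integrable_and_integral_eq_twisted` as well, every ball past
the coset level carries the WHOLE twisted rank-one stage: `∫_{x ∈ 𝔭^{−k}} conj ψ(σx) f(w₀ u(x) y) dμ = ∫ conj ψ(σx) f(w₀ u(x) y) dμ` (`k ≥ m`).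
[cite: CasselmanShalika1980, §2] [cite: Casselman1980, §3 Thm. 3.1] -/
theorem setIntegral_ball_twisted_eq_integral {f : G → ℂ} {K' : Subgroup G} (hfK : ∀ g, ∀ k ∈ K', f (g * k) = f g)
    {u ū : w.adicCompletion K → G} (hu_add : ∀ x t, u (x + t) = u x * u t) (w₀ : G)
    (ν : (w.adicCompletion K)ˣ →* ℂˣ) (e C₀ : ℂ)
    (hrel : ∀ (x : (w.adicCompletion K)ˣ) (g : G),
      f (w₀ * u x * g) = C₀ * (((ν x)⁻¹ : ℂˣ) : ℂ) * ((normAbs (w.adicCompletion K) (x : w.adicCompletion K) : ℝ) : ℂ) ^ (-e) *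
        f (ū ((x⁻¹ : (w.adicCompletion K)ˣ) : w.adicCompletion K) * g))
    (ψ : AddChar (w.adicCompletion K) Circle) (σ : w.adicCompletion K)
    (y : G) (m₀ m : ℕ) (hm : m₀ ≤ m)
    (hmu : ∀ t ∈ primePowBall (w.adicCompletion K) (m₀ : ℤ), y⁻¹ * u t * y ∈ K')
    (hmū : ∀ t ∈ primePowBall (w.adicCompletion K) (m₀ : ℤ), y⁻¹ * ū t * y ∈ K')
    (hint₀ : Integrable (fun x => f (w₀ * u x * y)) μ)
    (hσm : ∀ t ∈ primePowBall (w.adicCompletion K) (m : ℤ), ψ (σ * t) = 1)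
    (htail : ∃ t₀ ∈ primePowBall (w.adicCompletion K) (2 * (m₀ : ℤ) - m), ψ (σ * t₀) ≠ 1)
    (R : Finset (w.adicCompletion K))
    (hRinc : ∀ a ∈ R, ∀ a' ∈ R, a ≠ a' → a - a' ∉ primePowBall (w.adicCompletion K) (m : ℤ))
    (hRcov : primePowBall (w.adicCompletion K) (-(m : ℤ)) = ⋃ a ∈ R, {x | x - a ∈ primePowBall (w.adicCompletion K) (m : ℤ)})
    (k : ℕ) (hk : m ≤ k) :
    ∫ x in primePowBall (w.adicCompletion K) (-(k : ℤ)), conj ((ψ (σ * x) : ℂ)) * f (w₀ * u x * y) ∂μ =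
      ∫ x, conj ((ψ (σ * x) : ℂ)) * f (w₀ * u x * y) ∂μ := by
  rw [setIntegral_ball_twisted_eq_sum μ hfK hu_add w₀ ν e C₀ hrel ψ σ y m₀ m hm hmu hmū hσm htail R hRinc hRcov k hk,
    (integrable_and_integral_eq_twisted μ hfK hu_add w₀ ν e C₀ hrel ψ σ y m₀ m hm hmu hmū hint₀ hσm htail R hRinc hRcov).2]

end Fixed

/-! ## §3 The family form with the BALL clause: `N s g` is the ball-`k` twisted integral for every `k ≥ k₀(g)` and EVERY `s` -/

section Family

variable {K : Type} [Field K] [NumberField K] {w : HeightOneSpectrum (𝓞 K)} {G : Type*} [Group G] [TopologicalSpace G] [IsTopologicalGroup G]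
variable [MeasurableSpace (w.adicCompletion K)] [BorelSpace (w.adicCompletion K)] (μ : Measure (w.adicCompletion K)) [μ.IsAddHaarMeasure]

/-- **THE TWISTED RANK-ONE STAGE OF THE COCYCLE, FAMILY FORM WITH THE BALL CLAUSE** (ball edition of ★ `K2LiuRankOneStageTwisted.exists_twisted_family`: SAME
binders VERBATIM, SAME explicit `N s g = Σ_{a ∈ R(g)} μ(𝔭^{m(g)}) · conj ψ(σa) · Φ_s(w₀ u(a) g)`, its two clauses VERBATIM, plus the ball clause).  (i) for every `s₀`,
`g`: `q₀^{-s}`-rationality-and-regularity of all point values at `s₀` passes to `s ↦ N s g`; (ii) on `1 < re s`: `x ↦ conj ψ(σx) Φ_s(w₀ u(x) g)` is integrable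
and `∫ conj ψ(σx) Φ_s(w₀ u(x) g) dμ = N s g`; **(iii) for every `g` there is ONE ball threshold `k₀` (`= m(g)`, `s`-free) such that at EVERY `s` at which the
section `Φ_s` is right-`K′`-invariant and satisfies the `SL₂` relation (the two letters (ii) assumes on the half-plane — standard Siegel families carry them at
every `s`, ★ `apply_weylTwo_uLongTwo_coord_of_isLocalSiegelSection`; continued families get them by the identity principle ★ `IsQRationalRegularAt.eq_of_eqOn_halfPlane`,
see `exists_twisted_family_ball_regular`), `N s g = ∫_{x ∈ 𝔭^{−k}} conj ψ(σx) Φ_s(w₀ u(x) g) dμ(x)` for all `k ≥ k₀`** — NO integrability: the continued twisted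
stage is «a value stable on balls» (the `hWfac` shape of ★ p862742 with `cW := 1`), in particular at `s = ½` where (ii)'s integral does not converge absolutely.
[cite: Casselman1980, §3 Thm. 3.1] [cite: CasselmanShalika1980, §2] [cite: Tate1950, §2.5] [cite: KudlaRallis1994, §2] -/
theorem exists_twisted_family_ball (Φ : ℂ → G → ℂ) {K' : Subgroup G} (hK' : IsOpen (K' : Set G))
    (hΦK : ∀ s : ℂ, 1 < s.re → ∀ g, ∀ k ∈ K', Φ s (g * k) = Φ s g)
    {u ū : w.adicCompletion K → G} (hu : Continuous u) (hu0 : u 0 = 1) (hū : Continuous ū) (hū0 : ū 0 = 1) (hu_add : ∀ x t, u (x + t) = u x * u t) (w₀ : G)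
    (ν : (w.adicCompletion K)ˣ →* ℂˣ) (hν : ∀ x, ‖((ν x : ℂˣ) : ℂ)‖ = 1) (a : ℕ) (c : ℂ) (he : ∀ s : ℂ, 1 < s.re → 1 < ((a : ℂ) * s + c).re)
    (C₀ : ℂ → ℂ)
    (hrel : ∀ s : ℂ, 1 < s.re → ∀ (x : (w.adicCompletion K)ˣ) (g : G),
      Φ s (w₀ * u x * g) = C₀ s * (((ν x)⁻¹ : ℂˣ) : ℂ) * ((normAbs (w.adicCompletion K) (x : w.adicCompletion K) : ℝ) : ℂ) ^ (-((a : ℂ) * s + c)) *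
        Φ s (ū ((x⁻¹ : (w.adicCompletion K)ˣ) : w.adicCompletion K) * g))
    (ψ : AddChar (w.adicCompletion K) Circle) {mψ : ℤ} (hmψ : ψ.HasConductorExp mψ) {σ : w.adicCompletion K} (hσ : σ ≠ 0) :
    ∃ N : ℂ → G → ℂ,
      (∀ (q₀ : ℕ) (s₀ : ℂ) (g : G), (∀ g' : G, IsQRationalRegularAt q₀ s₀ fun s => Φ s g') → IsQRationalRegularAt q₀ s₀ fun s => N s g) ∧
      (∀ s : ℂ, 1 < s.re → ∀ g,
        Integrable (fun x => conj ((ψ (σ * x) : ℂ)) * Φ s (w₀ * u x * g)) μ ∧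
          ∫ x, conj ((ψ (σ * x) : ℂ)) * Φ s (w₀ * u x * g) ∂μ = N s g) ∧
      ∀ g : G, ∃ k₀ : ℕ, ∀ s : ℂ, (∀ g', ∀ k ∈ K', Φ s (g' * k) = Φ s g') →
        (∀ (x : (w.adicCompletion K)ˣ) (g' : G),
          Φ s (w₀ * u x * g') = C₀ s * (((ν x)⁻¹ : ℂˣ) : ℂ) * ((normAbs (w.adicCompletion K) (x : w.adicCompletion K) : ℝ) : ℂ) ^ (-((a : ℂ) * s + c)) *
            Φ s (ū ((x⁻¹ : (w.adicCompletion K)ˣ) : w.adicCompletion K) * g')) →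
        ∀ k : ℕ, k₀ ≤ k → N s g = ∫ x in primePowBall (w.adicCompletion K) (-(k : ℤ)), conj ((ψ (σ * x) : ℂ)) * Φ s (w₀ * u x * g) ∂μ := by
  have hq0 : (0 : ℝ≥0) < (residueFieldCard (w.adicCompletion K) : ℝ≥0)⁻¹ := inv_residueFieldCard_pos
  -- `‖σ‖ = (q⁻¹)^j`
  obtain ⟨j, hj⟩ := exists_normAbs_eq_inv_zpow hσ
  -- the level at each point, chosen once
  choose m₀ hmu hmū using fun g => exists_level₂ u ū hu hu0 hū hū0 K' hK' g
  -- the coset level: past the level, past the HEAD threshold `mψ − j`, past the TAIL threshold `j − mψ + 2 m₀ + 1`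
  let m : G → ℕ := fun g => max (m₀ g) (max (mψ - j).toNat (j - mψ + 2 * (m₀ g) + 1).toNat)
  have hm₀m : ∀ g, m₀ g ≤ m g := fun g => le_max_left _ _
  have hmhead : ∀ g, mψ - j ≤ (m g : ℤ) := fun g => by
    have h1 : ((mψ - j).toNat : ℤ) ≤ (m g : ℤ) := by exact_mod_cast (le_max_left _ _).trans (le_max_right (m₀ g) _)
    exact (Int.self_le_toNat _).trans h1
  have hmtail : ∀ g, j - mψ + 2 * (m₀ g : ℤ) + 1 ≤ (m g : ℤ) := fun g => by
    have h1 : ((j - mψ + 2 * (m₀ g : ℤ) + 1).toNat : ℤ) ≤ (m g : ℤ) := by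
      exact_mod_cast (le_max_right _ _).trans (le_max_right (m₀ g) _)
    exact (Int.self_le_toNat _).trans h1
  -- representatives of `𝔭^{-m(g)} ⧸ 𝔭^{m(g)}`
  have hR : ∀ g : G, ∃ R : Finset (w.adicCompletion K),
      (∀ a₁ ∈ R, ∀ a₂ ∈ R, a₁ ≠ a₂ → a₁ - a₂ ∉ primePowBall (w.adicCompletion K) (m g : ℤ)) ∧
      primePowBall (w.adicCompletion K) (-(m g : ℤ)) = ⋃ a₁ ∈ R, {x | x - a₁ ∈ primePowBall (w.adicCompletion K) (m g : ℤ)} := fun g => by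
    obtain ⟨R, -, hRinc, hRcov⟩ := exists_finset_primePowBall_eq_biUnion (F := w.adicCompletion K) (j := -(m g : ℤ)) (r := (m g : ℤ)) (by omega)
    exact ⟨R, hRinc, hRcov⟩
  choose R hRinc hRcov using hR
  -- the two thresholds
  have hσm : ∀ g, ∀ t ∈ primePowBall (w.adicCompletion K) (m g : ℤ), ψ (σ * t) = 1 := fun g t ht => by
    refine hmψ.1 _ ((mul_mem_primePowBall_iff hj).2 (primePowBall_antitone ?_ ht))
    linarith [hmhead g]
  have htail : ∀ g, ∃ t₀ ∈ primePowBall (w.adicCompletion K) (2 * (m₀ g : ℤ) - m g), ψ (σ * t₀) ≠ 1 := fun g => by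
    have hσout : σ ∉ primePowBall (w.adicCompletion K) (mψ - (2 * (m₀ g : ℤ) - m g)) := by
      rw [mem_primePowBall_iff, hj, not_le]
      exact (zpow_lt_zpow_iff_right_of_lt_one₀ hq0 inv_residueFieldCard_lt_one).2 (by linarith [hmtail g])
    obtain ⟨t₀, ht₀, hne⟩ := exists_mem_primePowBall_addChar_mul_ne_one hmψ hσout
    exact ⟨t₀, ht₀, by rwa [mul_comm] at hne⟩
  refine ⟨fun s g => ∑ a₁ ∈ R g, (μ.real (primePowBall (w.adicCompletion K) (m g : ℤ)) : ℂ) * (conj ((ψ (σ * a₁) : ℂ)) * Φ s (w₀ * u a₁ * g)),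
    fun q₀ s₀ g hreg => ?_, fun s hs g => ?_, fun g => ⟨m g, fun s hK hrels k hk => ?_⟩⟩
  · exact IsQRationalRegularAt.sum (R g) fun a₁ _ => ((hreg (w₀ * u a₁ * g)).const_mul _).const_mul _
  · have hint₀ : Integrable (fun x => Φ s (w₀ * u x * g)) μ :=
      integrable_of_letters μ hK' (hΦK s hs) hu hu0 hū hū0 hu_add w₀ ν hν _ (C₀ s) (he s hs) (hrel s hs) g
    exact integrable_and_integral_eq_twisted μ (hΦK s hs) hu_add w₀ ν _ (C₀ s) (hrel s hs) ψ σ g (m₀ g) (m g) (hm₀m g)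
      (hmu g) (hmū g) hint₀ (hσm g) (htail g) (R g) (hRinc g) (hRcov g)
  · exact (setIntegral_ball_twisted_eq_sum μ hK hu_add w₀ ν _ (C₀ s) hrels ψ σ g (m₀ g) (m g) (hm₀m g)
      (hmu g) (hmū g) (hσm g) (htail g) (R g) (hRinc g) (hRcov g) k hk).symm

omit [MeasurableSpace (w.adicCompletion K)] [BorelSpace (w.adicCompletion K)] in
/-- **`s ↦ ‖x‖^{−(a s + c)}` IS A LAURENT MONOMIAL IN `q₀^{-s}`** (`x ≠ 0`, `q_w = q₀^d`): `‖x‖ = q_w^{−j}` for some `j ∈ ℤ`, so `‖x‖^{−(a s + c)} = (q_w^{j})^{a s + c}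
= q_w^{jc} · (q₀^{-s})^{−d j a}` — `q₀^{-s}`-rational and regular at EVERY `s₀` (★ `isQRationalRegularAt_zpow_cpow_add` ∘ `comp_affine` ∘ `of_base_pow`).  This is the
`‖x‖^{−e(s)}` factor of the `SL₂` relation `hrel`; with it the relation is an identity between `q₀^{-s}`-rational functions and transfers from the half-plane
`1 < re s` to every regular point. [cite: Casselman1980, §3 Thm. 3.1] [cite: KudlaSweet1997, §1] -/
theorem isQRationalRegularAt_normAbs_cpow_neg_affine (q₀ d : ℕ) (hq : residueFieldCard (w.adicCompletion K) = q₀ ^ d)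
    {x : w.adicCompletion K} (hx : x ≠ 0) (a : ℕ) (c s₀ : ℂ) :
    IsQRationalRegularAt q₀ s₀ fun s => ((normAbs (w.adicCompletion K) x : ℝ) : ℂ) ^ (-((a : ℂ) * s + c)) := by
  have hqw0 : residueFieldCard (w.adicCompletion K) ≠ 0 := residueFieldCard_ne_zero _
  obtain ⟨j, hj⟩ := exists_normAbs_eq_inv_zpow hx
  have hq0r : (0 : ℝ) < (residueFieldCard (w.adicCompletion K) : ℝ) := by exact_mod_cast Nat.pos_of_ne_zero hqw0
  have hpos : (0 : ℝ) < (residueFieldCard (w.adicCompletion K) : ℝ) ^ j := zpow_pos hq0r j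
  have harg : ((((residueFieldCard (w.adicCompletion K) : ℝ) ^ j : ℝ) : ℂ)).arg ≠ Real.pi := by
    rw [Complex.arg_ofReal_of_nonneg hpos.le]; exact Real.pi_ne_zero.symm
  have hbase : IsQRationalRegularAt (residueFieldCard (w.adicCompletion K)) s₀ fun s =>
      ((((residueFieldCard (w.adicCompletion K) : ℝ) ^ j : ℝ) : ℂ)) ^ (((a : ℂ) * s + c) + 0) :=
    (K2LiuFlatSiegelFamilies.isQRationalRegularAt_zpow_cpow_add hqw0 j 0 ((a : ℂ) * s₀ + c)).comp_affine hqw0 a c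
  have hbase' : IsQRationalRegularAt (residueFieldCard (w.adicCompletion K)) s₀ fun s =>
      ((normAbs (w.adicCompletion K) x : ℝ) : ℂ) ^ (-((a : ℂ) * s + c)) := by
    refine hbase.congr fun s => ?_
    show ((((residueFieldCard (w.adicCompletion K) : ℝ) ^ j : ℝ) : ℂ)) ^ (((a : ℂ) * s + c) + 0) =
      ((normAbs (w.adicCompletion K) x : ℝ) : ℂ) ^ (-((a : ℂ) * s + c))
    rw [add_zero, hj, NNReal.coe_zpow, NNReal.coe_inv, NNReal.coe_natCast, inv_zpow, Complex.ofReal_inv, Complex.inv_cpow _ _ harg,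
      ← Complex.cpow_neg, neg_neg]
  rw [hq] at hbase'
  exact hbase'.of_base_pow

/-- **THE BALL CLAUSE AT EVERY REGULAR POINT — continued families** (the form the K1-a♮ chain consumes).  Same binders as `exists_twisted_family_ball` (= ★
`exists_twisted_family` VERBATIM) plus a base `q₀ ≥ 2` with `q_w = q₀^d`; same `N`, clauses (i)(ii) VERBATIM, and **(iii′) for every `g` ONE threshold `k₀` such that at
every `s₀` where all point values `s ↦ Φ_s(g′)` and the scalar `s ↦ C₀(s)` are `q₀^{-s}`-rational and regular, `N s₀ g = ∫_{x ∈ 𝔭^{−k}} conj ψ(σx) Φ_{s₀}(w₀ u(x) g) dμ`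
for all `k ≥ k₀`.**  The two letters `exists_twisted_family_ball` (iii) wants at `s₀` — right-`K′`-invariance of `Φ_{s₀}` and its `SL₂` relation — are TRANSFERRED from
the half-plane `1 < re s` by the identity principle ★ `IsQRationalRegularAt.eq_of_eqOn_halfPlane` (both sides are `q₀^{-s}`-rational and regular at `s₀`: point values,
`C₀`, and the monomial `‖x‖^{−(as+c)}` of `isQRationalRegularAt_normAbs_cpow_neg_affine`).  In ★ p29's chain (`K2LiuRankOneSingularLocalRegularity` §2) the stage-B
family `N₂` has all point values regular at every `s₀` and `C₀ = localSiegelCharacter(…)·const` is regular, so (iii′) reads the CONTINUED bad-place factor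
`Gn_v(s₀, h) = c_N·L_F(2s₀+1)·L_{E∕F}(2s₀)·N₃(s₀, h)` at `s₀ = ½` as «const × a value stable on balls» — the `hWfac` letter. [cite: Casselman1980, §3 Thm. 3.1]
[cite: CasselmanShalika1980, §2] [cite: KudlaSweet1997, §1] [cite: KudlaRallis1994, §2] -/
theorem exists_twisted_family_ball_regular (Φ : ℂ → G → ℂ) {K' : Subgroup G} (hK' : IsOpen (K' : Set G))
    (hΦK : ∀ s : ℂ, 1 < s.re → ∀ g, ∀ k ∈ K', Φ s (g * k) = Φ s g)
    {u ū : w.adicCompletion K → G} (hu : Continuous u) (hu0 : u 0 = 1) (hū : Continuous ū) (hū0 : ū 0 = 1) (hu_add : ∀ x t, u (x + t) = u x * u t) (w₀ : G)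
    (ν : (w.adicCompletion K)ˣ →* ℂˣ) (hν : ∀ x, ‖((ν x : ℂˣ) : ℂ)‖ = 1) (a : ℕ) (c : ℂ) (he : ∀ s : ℂ, 1 < s.re → 1 < ((a : ℂ) * s + c).re)
    (C₀ : ℂ → ℂ)
    (hrel : ∀ s : ℂ, 1 < s.re → ∀ (x : (w.adicCompletion K)ˣ) (g : G),
      Φ s (w₀ * u x * g) = C₀ s * (((ν x)⁻¹ : ℂˣ) : ℂ) * ((normAbs (w.adicCompletion K) (x : w.adicCompletion K) : ℝ) : ℂ) ^ (-((a : ℂ) * s + c)) *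
        Φ s (ū ((x⁻¹ : (w.adicCompletion K)ˣ) : w.adicCompletion K) * g))
    (ψ : AddChar (w.adicCompletion K) Circle) {mψ : ℤ} (hmψ : ψ.HasConductorExp mψ) {σ : w.adicCompletion K} (hσ : σ ≠ 0)
    (q₀ d : ℕ) (hq₀ : 2 ≤ q₀) (hq : residueFieldCard (w.adicCompletion K) = q₀ ^ d) :
    ∃ N : ℂ → G → ℂ,
      (∀ (q₁ : ℕ) (s₀ : ℂ) (g : G), (∀ g' : G, IsQRationalRegularAt q₁ s₀ fun s => Φ s g') → IsQRationalRegularAt q₁ s₀ fun s => N s g) ∧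
      (∀ s : ℂ, 1 < s.re → ∀ g,
        Integrable (fun x => conj ((ψ (σ * x) : ℂ)) * Φ s (w₀ * u x * g)) μ ∧
          ∫ x, conj ((ψ (σ * x) : ℂ)) * Φ s (w₀ * u x * g) ∂μ = N s g) ∧
      ∀ g : G, ∃ k₀ : ℕ, ∀ s₀ : ℂ, (∀ g' : G, IsQRationalRegularAt q₀ s₀ fun s => Φ s g') → IsQRationalRegularAt q₀ s₀ C₀ →
        ∀ k : ℕ, k₀ ≤ k → N s₀ g = ∫ x in primePowBall (w.adicCompletion K) (-(k : ℤ)), conj ((ψ (σ * x) : ℂ)) * Φ s₀ (w₀ * u x * g) ∂μ := by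
  obtain ⟨N, hreg, hval, hball⟩ := exists_twisted_family_ball μ Φ hK' hΦK hu hu0 hū hū0 hu_add w₀ ν hν a c he C₀ hrel ψ hmψ hσ
  refine ⟨N, hreg, hval, fun g => ?_⟩
  obtain ⟨k₀, hk₀⟩ := hball g
  refine ⟨k₀, fun s₀ hΦreg hC₀ k hk => hk₀ s₀ (fun g' k' hk' => ?_) (fun x g' => ?_) k hk⟩
  · -- right-`K′`-invariance at `s₀`, transferred from the half-plane
    exact IsQRationalRegularAt.eq_of_eqOn_halfPlane hq₀ (hΦreg (g' * k')) (hΦreg g') 1 fun s hs => hΦK s hs g' k' hk'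
  · -- the `SL₂` relation at `s₀`, transferred from the half-plane
    have hmono := isQRationalRegularAt_normAbs_cpow_neg_affine (K := K) (w := w) q₀ d hq (x := (x : w.adicCompletion K)) x.ne_zero a c s₀
    have hR : IsQRationalRegularAt q₀ s₀ fun s => C₀ s * (((ν x)⁻¹ : ℂˣ) : ℂ) *
        ((normAbs (w.adicCompletion K) (x : w.adicCompletion K) : ℝ) : ℂ) ^ (-((a : ℂ) * s + c)) *
          Φ s (ū ((x⁻¹ : (w.adicCompletion K)ˣ) : w.adicCompletion K) * g') :=
      ((hC₀.mul (isQRationalRegularAt_const q₀ s₀ _)).mul hmono).mul (hΦreg _)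
    exact IsQRationalRegularAt.eq_of_eqOn_halfPlane hq₀ (hΦreg _) hR 1 fun s hs => hrel s hs x g'

end Family

end Summit.HodgeConjecture.HodgeConjecture.Cruxes.HLiu418.K2LiuRankOneStageTwistedBall

end
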